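import Mathlib.Analysis.Calculus.Deriv.Prod
import Mathlib.Analysis.Calculus.Deriv.Mul
import Mathlib.Analysis.SpecialFunctions.ExpDeriv
import Mathlib.Analysis.ODE.ExistUnique
import HarnessLib

/-!
# The parameterization method for (un)stable manifolds: the invariance equation and the
# Parameterization Lemma (infinitesimal conjugacy ⇒ flow conjugacy ⇒ image in the (un)stable set)

Topic `Literature/Analysis/ODE`.  Everything PROVED; no named facts.

Source read (held): W. D. Kalies, S. Kepley, J. D. Mireles James, *Analytic continuation of local
(un)stable manifolds with rigorous computer assisted error bounds*, SIAM J. Appl. Dyn. Syst. **17**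
(2018) 157–202 = arXiv:1706.10107 [KaliesKepleyJames2017], §3 "The parameterization method for
(un)stable manifolds" (p. 11 of the held text):

> "Consider a real analytic vector field `f : ℝⁿ → ℝⁿ`, with `f` generating a flow `Φ` … Suppose that
> `p ∈ U` is an equilibrium solution, and let `λ₁, …, λ_d ∈ ℂ` denote the stable eigenvalues of the
> matrix `Df(p)`. Let `ξ₁, …, ξ_d` denote a choice of associated eigenvectors. In this section we write
> `B = {s ∈ ℝ^d : ‖s‖ < 1}` for the unit ball in `ℝ^d`.  The goal of the Parameterization Method is to
> solve the invariance equation `f(P(s)) = λ₁s₁ ∂P/∂s₁(s) + … + λ_d s_d ∂P/∂s_d(s)` (3.1) on `B`,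
> subject to the first order constraints `P(0) = p` and `∂P/∂s_j(0) = ξ_j` (3.2)."
> "**Lemma 3.1 (Parameterization Lemma).** Let `L : ℝ^d × ℝ → ℝ^d` be the linear flow
> `L(s,t) = (e^{λ₁t}s₁, …, e^{λ_d t}s_d)`. Let `P : B ⊂ ℝ^d → ℝⁿ` be a smooth function satisfying
> Equation (3.1) on `B` and subject to the constraints given by Equation (3.2). Then `P(s)` satisfies
> the flow conjugacy `Φ(P(s), t) = P(L(s,t))`, for all `t ≥ 0` and `s ∈ B`."
> "Note also that the converse of the lemma holds, so that `P` satisfies the flow conjugacy if and only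
> if `P` satisfies the infinitesimal conjugacy. … Now, one checks that if `P` satisfies the flow
> conjugacy …, then `P(B) ⊂ W^s(p)`, i.e. the image of `P` is a local stable manifold. This is seen by
> considering that `lim_{t→∞} Φ(P(s), t) = lim_{t→∞} P(L(s,t)) = p` …, which exploits the flow
> conjugacy, the fact that `L` is stable linear flow, and that `P` is continuous."

The same lemma (for the UNSTABLE manifold: unstable eigenvalues, `t ≤ 0`) is the analytic backbone of
the validated parameterization computations of J. B. van den Berg, J. D. Mireles James, C. Reinhardt,
*Computing (un)stable manifolds with validated error bounds: non-resonant and resonant spectra*,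
J. Nonlinear Sci. **26** (2016) 1055–1095 [VandenbergMirelesjamesReinhardt2016] (not held; cited for
orientation only — every `[cite:]` tag below points at the held restatement [KaliesKepleyJames2017]);
the a-posteriori (radii-polynomial) step of such computations is
`Literature.Analysis.Calculus.RadiiPolynomial`.

## Rendering

* Parameter space `S` and phase space `E` are real normed spaces (printed: `ℝ^d`, `ℝⁿ`); the linear
  vector field is any `Λ : S →L[ℝ] S` (printed: `Λ = diag(λ₁, …, λ_d)`, real here) and the "linear
  flow" is any curve `σ` with `σ' = Λσ` (printed: `σ(t) = L(s,t)`), so the general statements need no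
  matrix exponential; the printed diagonal flow is `diagonalFlow μ s t = (e^{μ_j t} s_j)_j` on
  `Fin d → ℝ` (sup norm) with vector field `diagonalField μ`.
* `IsInvarianceSolutionOn f Λ P P' B`: `P` has Fréchet derivative `P' s` at every `s ∈ B` and
  `P'(s)[Λs] = f(P(s))` there — equation (3.1), "the push forward by `P` of the linear vector field
  … is equal to the vector field `f` restricted to the image of `P`".
* Lemma 3.1 is proved in two layers: (i) `IsInvarianceSolutionOn.hasDerivAt_comp` — the chain rule
  turns (3.1) into "`t ↦ P(σ(t))` solves `x' = f(x)` while `σ(t) ∈ B`" (the content of the lemma;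
  the printed `Φ(P(s),t) = P(L(s,t))` is this plus uniqueness of solutions), and (ii)
  `IsInvarianceSolutionOn.eqOn_of_solution` — for `f` Lipschitz on a set containing both curves, ANY
  solution `y` of `y' = f(y)` on `[a,b]` with `y(a) = P(σ(a))` equals `P ∘ σ` on `[a,b]` (Mathlib's
  `ODE_solution_unique_of_mem_Icc_right`): the flow conjugacy with `Φ` represented by its trajectories.
  `parameterizationLemma_stable` assembles the printed instance (`μ_j < 0`, `B` the unit ball, `t ≥ 0`).
* The remark `P(B) ⊂ W^s(p)`: `tendsto_comp_of_tendsto_zero` (continuity of `P` at `0` and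
  `σ(t) → 0`; filter `atTop` = stable, `atBot` = unstable), `tendsto_diagonalFlow_atTop/atBot`; and
  `IsInvarianceSolutionOn.apply_zero` — (3.1) at `s = 0` forces `f(P(0)) = 0` (so the constraint
  `P(0) = p` can only be met at an equilibrium `p`).

## WHAT THIS IS NOT
Not an existence theorem for (3.1) (non-resonance conditions, [VandenbergMirelesjamesReinhardt2016]),
not the analyticity of `P`, and not a validated-numerics bound: those CAP theorems have as a-posteriori
step `Literature.Analysis.Calculus.existsUnique_zero_of_radiiPolynomial`; this file is only the exact
conjugacy logic that turns a solution of the invariance equation into an invariant-manifold chart.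

## Mathlib / tree search
`lean search 'invariance equation|parameterization method|stable manifold|flow conjugacy'`: nothing in
Mathlib or `Literature` (the Balaban `EriceFlowEnclosure…` "step–flow conjugacy" files are unrelated).
Mathlib used: `HasFDerivAt.comp_hasDerivAt` (chain rule along a curve),
`ODE_solution_unique_of_mem_Icc_right`, `hasDerivAt_pi`, `Real.hasDerivAt_exp`, `tendsto_pi_nhds`.
-/

noncomputable section

open Set Filter Metric
open scoped Topology

namespace Literature.Analysis.ODE

variable {S E : Type*} [NormedAddCommGroup S] [NormedSpace ℝ S] [NormedAddCommGroup E]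
  [NormedSpace ℝ E]

/-- **The invariance equation of the parameterization method** on a set `B` of parameters
(Kalies–Kepley–Mireles James (3.1), with a general linear field `Λ` in place of
`diag(λ₁, …, λ_d)`): `P` is Fréchet differentiable at every `s ∈ B` with derivative `P'(s)`, and
`P'(s)[Λ s] = f(P(s))` — "the push forward by `P` of the linear vector field generated by the stable
eigenvalues is equal to the vector field `f` restricted to the image of `P`".
[cite: KaliesKepleyJames2017, §3 eq. (3.1)] -/
def IsInvarianceSolutionOn (f : E → E) (Λ : S →L[ℝ] S) (P : S → E) (P' : S → S →L[ℝ] E)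
    (B : Set S) : Prop :=
  ∀ s ∈ B, HasFDerivAt P (P' s) s ∧ P' s (Λ s) = f (P s)

namespace IsInvarianceSolutionOn

variable {f : E → E} {Λ : S →L[ℝ] S} {P : S → E} {P' : S → S →L[ℝ] E} {B : Set S}

/-- Restriction of the invariance equation to a smaller parameter set.
[cite: KaliesKepleyJames2017, §3 eq. (3.1)] -/
theorem mono (h : IsInvarianceSolutionOn f Λ P P' B) {B₀ : Set S} (hB : B₀ ⊆ B) :
    IsInvarianceSolutionOn f Λ P P' B₀ :=
  fun s hs => h s (hB hs)

/-- At `s = 0` the invariance equation reads `f(P(0)) = P'(0)[Λ 0] = 0`: the base point `P(0)` is an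
equilibrium (consistent with the constraint `P(0) = p`, (3.2)).
[cite: KaliesKepleyJames2017, §3 eqs. (3.1)–(3.2)] -/
theorem apply_zero (h : IsInvarianceSolutionOn f Λ P P' B) (h0 : (0 : S) ∈ B) : f (P 0) = 0 := by
  have h' := (h 0 h0).2
  rw [map_zero, map_zero] at h'
  exact h'.symm

/-- **Parameterization Lemma, derivative form** (infinitesimal conjugacy ⇒ conjugacy of orbits): if
`σ` is an integral curve of the linear field, `σ'(t) = Λσ(t)`, and `σ(t) ∈ B`, then `x = P ∘ σ`
satisfies `x'(t) = f(x(t))`.  This is the chain-rule content of Lemma 3.1: with `σ(t) = L(s,t)` it says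
that `t ↦ P(L(s,t))` is the trajectory of `f` through `P(s)`.
[cite: KaliesKepleyJames2017, §3 Lemma 3.1] -/
theorem hasDerivAt_comp (h : IsInvarianceSolutionOn f Λ P P' B) {σ : ℝ → S} {t : ℝ}
    (hσ : HasDerivAt σ (Λ (σ t)) t) (ht : σ t ∈ B) :
    HasDerivAt (fun τ => P (σ τ)) (f (P (σ t))) t := by
  have hc := (h _ ht).1.comp_hasDerivAt t hσ
  rw [(h _ ht).2] at hc
  exact hc

/-- **Parameterization Lemma, flow-conjugacy form `Φ(P(s), t) = P(L(s,t))`** (Lemma 3.1), with the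
flow `Φ` represented by its trajectories: if `f` is Lipschitz on a set `U` containing both curves,
`σ' = Λσ` on `[a,b]` with `σ([a,b]) ⊆ B`, and `y` is any solution of `y' = f(y)` on `[a,b]` with
`y(a) = P(σ(a))`, then `y = P ∘ σ` on `[a,b]` (uniqueness of solutions, Mathlib's
`ODE_solution_unique_of_mem_Icc_right`). [cite: KaliesKepleyJames2017, §3 Lemma 3.1] -/
theorem eqOn_of_solution (h : IsInvarianceSolutionOn f Λ P P' B) {K : NNReal} {U : Set E}
    (hf : LipschitzOnWith K f U) {σ : ℝ → S} {y : ℝ → E} {a b : ℝ}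
    (hσ : ∀ t ∈ Icc a b, HasDerivAt σ (Λ (σ t)) t) (hσB : ∀ t ∈ Icc a b, σ t ∈ B)
    (hPU : ∀ t ∈ Icc a b, P (σ t) ∈ U)
    (hy : ∀ t ∈ Icc a b, HasDerivAt y (f (y t)) t) (hyU : ∀ t ∈ Icc a b, y t ∈ U)
    (ha : y a = P (σ a)) : EqOn y (fun t => P (σ t)) (Icc a b) := by
  have hx : ∀ t ∈ Icc a b, HasDerivAt (fun τ => P (σ τ)) (f (P (σ t))) t :=
    fun t ht => h.hasDerivAt_comp (hσ t ht) (hσB t ht)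
  exact ODE_solution_unique_of_mem_Icc_right (v := fun _ => f) (s := fun _ => U)
    (fun _ _ => hf)
    (fun t ht => (hy t ht).continuousAt.continuousWithinAt)
    (fun t ht => (hy t (Ico_subset_Icc_self ht)).hasDerivWithinAt)
    (fun t ht => hyU t (Ico_subset_Icc_self ht))
    (fun t ht => (hx t ht).continuousAt.continuousWithinAt)
    (fun t ht => (hx t (Ico_subset_Icc_self ht)).hasDerivWithinAt)
    (fun t ht => hPU t (Ico_subset_Icc_self ht))
    ha

end IsInvarianceSolutionOn

omit [NormedSpace ℝ S] [NormedSpace ℝ E] in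
/-- The remark "`P(B) ⊂ W^s(p)` … `lim_{t→∞} P(L(s,t)) = p` … exploits … that `L` is stable linear
flow, and that `P` is continuous": if `σ(t) → 0` along a filter (`atTop`: stable case; `atBot`:
unstable case) and `P` is continuous at `0`, then `P(σ(t)) → P(0)`.
[cite: KaliesKepleyJames2017, §3 (after Lemma 3.1)] -/
theorem tendsto_comp_of_tendsto_zero {P : S → E} {σ : ℝ → S} {l : Filter ℝ}
    (hP : ContinuousAt P 0) (hσ : Tendsto σ l (𝓝 0)) :
    Tendsto (fun t => P (σ t)) l (𝓝 (P 0)) :=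
  hP.tendsto.comp hσ

/-! ### The printed diagonal linear flow `L(s,t) = (e^{λ_j t} s_j)_j` -/

section Diagonal

variable {d : ℕ}

/-- The linear flow `L(s,t) = (e^{μ₁t}s₁, …, e^{μ_d t}s_d)` of Lemma 3.1 (real exponents `μ_j`), on
`ℝ^d = Fin d → ℝ`. [cite: KaliesKepleyJames2017, §3 Lemma 3.1] -/
def diagonalFlow (μ s : Fin d → ℝ) (t : ℝ) : Fin d → ℝ :=
  fun j => Real.exp (μ j * t) * s j

/-- The diagonal linear vector field `s ↦ (μ_j s_j)_j`, "the flow generated by the vector field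
`d s_j/dt = λ_j s_j`", as a continuous linear map. [cite: KaliesKepleyJames2017, §3 (after Lemma 3.1)] -/
def diagonalField (μ : Fin d → ℝ) : (Fin d → ℝ) →L[ℝ] (Fin d → ℝ) :=
  ContinuousLinearMap.pi fun j => μ j • ContinuousLinearMap.proj j

/-- `(diagonalField μ s)_j = μ_j s_j`. [cite: KaliesKepleyJames2017, §3 (after Lemma 3.1)] -/
@[simp] theorem diagonalField_apply (μ s : Fin d → ℝ) (j : Fin d) :
    diagonalField μ s j = μ j * s j := by
  simp [diagonalField]

/-- `L(s, 0) = s`. [cite: KaliesKepleyJames2017, §3 Lemma 3.1] -/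
@[simp] theorem diagonalFlow_zero (μ s : Fin d → ℝ) : diagonalFlow μ s 0 = s := by
  ext j
  simp [diagonalFlow]

/-- `L(s, ·)` is an integral curve of the diagonal field: `∂_t L(s,t) = Λ L(s,t)`.
[cite: KaliesKepleyJames2017, §3 Lemma 3.1] -/
theorem hasDerivAt_diagonalFlow (μ s : Fin d → ℝ) (t : ℝ) :
    HasDerivAt (diagonalFlow μ s) (diagonalField μ (diagonalFlow μ s t)) t := by
  refine hasDerivAt_pi.2 fun j => ?_
  have h1 : HasDerivAt (fun τ : ℝ => μ j * τ) (μ j) t := by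
    simpa using (hasDerivAt_id t).const_mul (μ j)
  have h2 : HasDerivAt (fun τ : ℝ => Real.exp (μ j * τ)) (Real.exp (μ j * t) * μ j) t :=
    (Real.hasDerivAt_exp _).comp t h1
  have h3 := h2.mul_const (s j)
  show HasDerivAt (fun τ : ℝ => Real.exp (μ j * τ) * s j) _ t
  refine h3.congr_deriv ?_
  simp only [diagonalField_apply, diagonalFlow]
  ring

/-- While `μ_j t ≤ 0` for all `j` (stable exponents and `t ≥ 0`, or unstable exponents and `t ≤ 0`),
`‖L(s,t)‖ ≤ ‖s‖` (sup norm): balls about `0` are mapped into themselves — the reason Lemma 3.1 holds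
"for all `t ≥ 0` and `s ∈ B`". [cite: KaliesKepleyJames2017, §3 Lemma 3.1] -/
theorem norm_diagonalFlow_le {μ : Fin d → ℝ} (s : Fin d → ℝ) {t : ℝ} (h : ∀ j, μ j * t ≤ 0) :
    ‖diagonalFlow μ s t‖ ≤ ‖s‖ := by
  refine (pi_norm_le_iff_of_nonneg (norm_nonneg s)).2 fun j => ?_
  have hj : ‖diagonalFlow μ s t j‖ = Real.exp (μ j * t) * ‖s j‖ := by
    simp only [diagonalFlow, norm_mul, Real.norm_eq_abs, abs_of_pos (Real.exp_pos _)]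
  rw [hj]
  calc Real.exp (μ j * t) * ‖s j‖ ≤ 1 * ‖s j‖ := by
        gcongr
        exact Real.exp_le_one_iff.2 (h j)
    _ = ‖s j‖ := one_mul _
    _ ≤ ‖s‖ := norm_le_pi_norm s j

/-- Stable exponents: `L(s,t) → 0` as `t → +∞`. [cite: KaliesKepleyJames2017, §3 (after Lemma 3.1)] -/
theorem tendsto_diagonalFlow_atTop {μ : Fin d → ℝ} (hμ : ∀ j, μ j < 0) (s : Fin d → ℝ) :
    Tendsto (diagonalFlow μ s) atTop (𝓝 0) := by
  refine tendsto_pi_nhds.2 fun j => ?_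
  have h : Tendsto (fun t : ℝ => Real.exp (μ j * t)) atTop (𝓝 0) :=
    Real.tendsto_exp_atBot.comp (tendsto_id.const_mul_atTop_of_neg (hμ j))
  simpa [diagonalFlow] using h.mul_const (s j)

/-- Unstable exponents: `L(s,t) → 0` as `t → −∞` (the case of the unstable manifold,
[VandenbergMirelesjamesReinhardt2016]). [cite: KaliesKepleyJames2017, §3 (after Lemma 3.1)] -/
theorem tendsto_diagonalFlow_atBot {μ : Fin d → ℝ} (hμ : ∀ j, 0 < μ j) (s : Fin d → ℝ) :
    Tendsto (diagonalFlow μ s) atBot (𝓝 0) := by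
  refine tendsto_pi_nhds.2 fun j => ?_
  have h : Tendsto (fun t : ℝ => Real.exp (μ j * t)) atBot (𝓝 0) :=
    Real.tendsto_exp_atBot.comp (tendsto_id.const_mul_atBot (hμ j))
  simpa [diagonalFlow] using h.mul_const (s j)

/-- **Lemma 3.1 as printed (stable case) with the remark `P(B) ⊂ W^s(p)`, trajectory form.**  Let
`μ_j < 0`, `B` the open unit ball of `ℝ^d` (sup norm), and `P` a solution of the invariance equation
(3.1) on `B` for the diagonal field.  Then for every `s ∈ B`: `x(t) = P(L(s,t))` satisfies
`x'(t) = f(x(t))` for all `t ≥ 0` (so, `f` being locally Lipschitz, `x(t) = Φ(P(s), t)` by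
`IsInvarianceSolutionOn.eqOn_of_solution`), and if `P` is continuous at `0` then `x(t) → P(0)` as
`t → ∞`. [cite: KaliesKepleyJames2017, §3 Lemma 3.1 (and the remark following it)] -/
theorem parameterizationLemma_stable {f : E → E} {μ : Fin d → ℝ} {P : (Fin d → ℝ) → E}
    {P' : (Fin d → ℝ) → (Fin d → ℝ) →L[ℝ] E} (hμ : ∀ j, μ j < 0)
    (hP : IsInvarianceSolutionOn f (diagonalField μ) P P' (ball 0 1)) {s : Fin d → ℝ}
    (hs : s ∈ ball (0 : Fin d → ℝ) 1) :
    (∀ t : ℝ, 0 ≤ t →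
        HasDerivAt (fun τ => P (diagonalFlow μ s τ)) (f (P (diagonalFlow μ s t))) t) ∧
      (ContinuousAt P 0 → Tendsto (fun t => P (diagonalFlow μ s t)) atTop (𝓝 (P 0))) := by
  refine ⟨fun t ht => hP.hasDerivAt_comp (hasDerivAt_diagonalFlow μ s t) ?_,
    fun hc => tendsto_comp_of_tendsto_zero hc (tendsto_diagonalFlow_atTop hμ s)⟩
  rw [mem_ball_zero_iff] at hs ⊢
  exact lt_of_le_of_lt (norm_diagonalFlow_le s fun j => by nlinarith [hμ j]) hs

/-- **The unstable case** (`μ_j > 0`, `t ≤ 0`; [VandenbergMirelesjamesReinhardt2016]): for `s ∈ B`,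
`x(t) = P(L(s,t))` solves `x' = f(x)` for all `t ≤ 0` and `x(t) → P(0)` as `t → −∞` when `P` is
continuous at `0` — the image of `P` consists of backward trajectories asymptotic to the equilibrium,
i.e. lies in its unstable set. [cite: KaliesKepleyJames2017, §3 Lemma 3.1 (time-reversed)] -/
theorem parameterizationLemma_unstable {f : E → E} {μ : Fin d → ℝ} {P : (Fin d → ℝ) → E}
    {P' : (Fin d → ℝ) → (Fin d → ℝ) →L[ℝ] E} (hμ : ∀ j, 0 < μ j)
    (hP : IsInvarianceSolutionOn f (diagonalField μ) P P' (ball 0 1)) {s : Fin d → ℝ}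
    (hs : s ∈ ball (0 : Fin d → ℝ) 1) :
    (∀ t : ℝ, t ≤ 0 →
        HasDerivAt (fun τ => P (diagonalFlow μ s τ)) (f (P (diagonalFlow μ s t))) t) ∧
      (ContinuousAt P 0 → Tendsto (fun t => P (diagonalFlow μ s t)) atBot (𝓝 (P 0))) := by
  refine ⟨fun t ht => hP.hasDerivAt_comp (hasDerivAt_diagonalFlow μ s t) ?_,
    fun hc => tendsto_comp_of_tendsto_zero hc (tendsto_diagonalFlow_atBot hμ s)⟩
  rw [mem_ball_zero_iff] at hs ⊢
  exact lt_of_le_of_lt (norm_diagonalFlow_le s fun j => by nlinarith [hμ j]) hs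

end Diagonal

end Literature.Analysis.ODE

end
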